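import Literature.NumberTheory.Transcendental.KZCalculus
import Literature.NumberTheory.Transcendental.KZKernelConjectureForms
import Literature.NumberTheory.Transcendental.KZRelationsLE
import Literature.NumberTheory.Transcendental.KZSubcalculusInvariants
import Literature.NumberTheory.Transcendental.KZLogCalculusProofs
import Literature.NumberTheory.Transcendental.KZVolumeConjectureProofs
import Literature.NumberTheory.Transcendental.KZSemiCanonicalReductionProofs
import Literature.NumberTheory.Transcendental.SemialgebraicVolume
import Literature.NumberTheory.Transcendental.KZDilationMove
import Literature.ModelTheory.ExponentialFields.SemialgebraicSigns
import Summits.KontsevichZagierPeriods.KontsevichZagierPeriods.Theorems.SymplecticScissorsVolumeFormOffPlaneScissors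
import Mathlib

/-!
# `WalshSpan` proof, part 1/3: the Walsh span and weighted scissors

Part 1/3 of the proof of item stmt-KontsevichZagierPeriods-25395 `RootDecompWalshStrata.WalshSpan`
(route RootDecompWalshStrata; decomposition cell decomp-kz, lens 4, gen 2 — port of `section Edges`/Edge W
of `run/shared/lean/pub/decomp-kz/decomp-kz-lens-4/WalshStrata.lean` v2, kernel-checked there).
Files: `…WalshSpanWeighted` (the Walsh span `walshSpanned`, weighted scissors) → `…WalshSpanCells`
(cube normal form, sign cells, Walsh sums) → `…WalshSpan` (the expansion and `walshSpan_proof`, which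
proves the route decl BY NAME). Reused landed/Literature results BY NAME: `LogPolytope.stub_scissors`,
`KZ.ratCast_smul_sub_mem_relations` [KZDilationMove], `KZ.scale`,
`IsSemialgebraic.exists_finset_signDetermined` [SemialgebraicSigns], `KZ.exists_translate`,
`KZ.exists_sub_isBounded`, `volume_setOf_aeval_eq_zero`.

This file: the set `walshSpanned` of classes in the `ℤ`-span of weighted Walsh cells modulo relations
and its closure properties; `weighted_scissors`: the scissors congruence for CONSTANT RATIONAL integrands
(unit representatives, common denominator, the landed signed scissors congruence
`SymplecticScissors.LogPolytope.stub_scissors` [Theorems/SymplecticScissorsVolumeFormOffPlaneScissors],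
and integer division in `KZ.relations` from the Literature scaling endomorphism `KZ.scale (1/k)` —
re-derived here as a private lemma because the landed `LadderDescent.mem_relations_of_nsmul_mem`
[Theorems/HurwitzMicroSectorsHurwitzSectorComplementStubLadderDescentAlgebra] has an import closure
outside the farm build). [KontsevichZagier2001 §1.2 rules (1)–(2)]
-/

noncomputable section

open Literature.NumberTheory.Transcendental
open Literature.ModelTheory.ExponentialFields
open MeasureTheory Set
open MvPolynomial (aeval X C)

namespace Summit.KontsevichZagierPeriods.RootDecompWalshStrata.WalshSpanProof

/-! #### Integer division in `KZ.relations` (torsion-freeness), from `KZ.scale` -/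

/-- `(k : ℝ)⁻¹` is algebraic over `ℚ`. [folklore] -/
private theorem isAlgebraic_inv_nat (k : ℕ) : IsAlgebraic ℚ ((k : ℝ)⁻¹) :=
  (isAlgebraic_nat k).inv

/-- `[σ, f] − k • [σ, f/k]` is a relation. [KontsevichZagier2001 §1.2 rule (1); folklore] -/
private theorem of_sub_nsmul_of_constMul_inv_mem_relations {n : ℕ} (r : KZ.IntegralRep n) {k : ℕ}
    (hk : k ≠ 0) :
    KZ.of r - k • KZ.of (r.constMul ((k : ℝ)⁻¹) (isAlgebraic_inv_nat k)) ∈ KZ.relations := by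
  set r₁ := r.constMul ((k : ℝ)⁻¹) (isAlgebraic_inv_nat k) with hr₁
  have h1 : KZ.of (r₁.constMul (k : ℝ) (isAlgebraic_nat k)) - k • KZ.of r₁ ∈ KZ.relations :=
    KZ.IntegralRep.of_constMul_nat_sub_nsmul_mem_relations r₁ k
  have h2 : KZ.of r - KZ.of (r₁.constMul (k : ℝ) (isAlgebraic_nat k)) ∈ KZ.relations := by
    refine KZ.of_sub_of_mem_relations_of_eqOn rfl fun x _ => ?_
    have hk' : (k : ℝ) ≠ 0 := Nat.cast_ne_zero.mpr hk
    simp only [hr₁, KZ.IntegralRep.integrand_constMul]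
    rw [← mul_assoc, mul_inv_cancel₀ hk', one_mul]
  have : KZ.of r - k • KZ.of r₁ = (KZ.of r - KZ.of (r₁.constMul (k : ℝ) (isAlgebraic_nat k))) +
      (KZ.of (r₁.constMul (k : ℝ) (isAlgebraic_nat k)) - k • KZ.of r₁) := by abel
  rw [this]
  exact KZ.relations.add_mem h2 h1

/-- Every formal combination `c` is congruent to `k • scale (1/k) c`. [folklore] -/
private theorem sub_nsmul_scale_inv_mem_relations {k : ℕ} (hk : k ≠ 0) (c : KZ.FormalRep) :
    c - k • KZ.scale ((k : ℝ)⁻¹) (isAlgebraic_inv_nat k) c ∈ KZ.relations := by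
  induction c using FreeAbelianGroup.induction_on with
  | zero => simp
  | of x =>
    obtain ⟨n, r⟩ := x
    change KZ.of r - k • KZ.scale ((k : ℝ)⁻¹) (isAlgebraic_inv_nat k) (KZ.of r) ∈ KZ.relations
    rw [KZ.scale_of]
    exact of_sub_nsmul_of_constMul_inv_mem_relations r hk
  | neg x hx =>
    obtain ⟨n, r⟩ := x
    change -KZ.of r - k • KZ.scale ((k : ℝ)⁻¹) (isAlgebraic_inv_nat k) (-KZ.of r) ∈ KZ.relations
    have : -KZ.of r - k • KZ.scale ((k : ℝ)⁻¹) (isAlgebraic_inv_nat k) (-KZ.of r) =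
        -(KZ.of r - k • KZ.scale ((k : ℝ)⁻¹) (isAlgebraic_inv_nat k) (KZ.of r)) := by
      rw [map_neg, smul_neg]; abel
    rw [this]
    exact KZ.relations.neg_mem hx
  | add x y hx hy =>
    have : x + y - k • KZ.scale ((k : ℝ)⁻¹) (isAlgebraic_inv_nat k) (x + y) =
        (x - k • KZ.scale ((k : ℝ)⁻¹) (isAlgebraic_inv_nat k) x) +
        (y - k • KZ.scale ((k : ℝ)⁻¹) (isAlgebraic_inv_nat k) y) := by
      rw [map_add, smul_add]; abel
    rw [this]
    exact KZ.relations.add_mem hx hy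

/-- **`FormalRep ⧸ relations` is torsion-free**: `k • c ∈ relations`, `k ≠ 0` ⟹ `c ∈ relations`.
(Re-derived from `KZ.scale_mem_relations`; the same statement is landed in several Theorems files,
e.g. `MultiplicationAccessible.Negative.mem_relations_of_nsmul_mem_relations`.) [folklore] -/
private theorem mem_relations_of_nsmul_mem_relations {k : ℕ} (hk : k ≠ 0) {c : KZ.FormalRep}
    (h : k • c ∈ KZ.relations) : c ∈ KZ.relations := by
  have h1 := sub_nsmul_scale_inv_mem_relations hk c
  have h2 : k • KZ.scale ((k : ℝ)⁻¹) (isAlgebraic_inv_nat k) c ∈ KZ.relations := by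
    rw [← map_nsmul]
    exact KZ.scale_mem_relations _ _ h
  simpa using KZ.relations.add_mem h1 h2

/-! #### W0 · the span of weighted Walsh cells modulo relations -/

/-- The set of `x : FormalRep` lying in the `ℤ`-span, modulo `KZ.relations`, of a finite family of
weighted Walsh cells `[(0,1)^{d i} ∩ {P i > 0}, q i]` (`q i ∈ ℚ` constant integrands). -/
def walshSpanned : Set KZ.FormalRep :=
  {x | ∃ (ι : Type) (_ : Fintype ι) (d : ι → ℕ) (P : (i : ι) → MvPolynomial (Fin (d i)) ℚ)
    (q : ι → ℚ) (ρ : (i : ι) → KZ.IntegralRep (d i)) (c : ι → ℤ),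
    (∀ i, (ρ i).domain = {x | (∀ j, 0 < x j ∧ x j < 1) ∧ 0 < MvPolynomial.aeval x (P i)} ∧
      ∀ x ∈ (ρ i).domain, (ρ i).integrand x = (q i : ℝ)) ∧
    x - ∑ i, c i • KZ.of (ρ i) ∈ KZ.relations}

/-- A relation is Walsh-spanned (empty family). [folklore] -/
theorem walshSpanned_of_mem_relations {x : KZ.FormalRep} (hx : x ∈ KZ.relations) :
    x ∈ walshSpanned :=
  ⟨Fin 0, inferInstance, Fin.elim0, fun i => i.elim0, Fin.elim0, fun i => i.elim0, Fin.elim0,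
    fun i => i.elim0, by simpa using hx⟩

/-- Walsh-spannedness only depends on the class modulo `KZ.relations`. [folklore] -/
theorem walshSpanned_congr {x y : KZ.FormalRep} (hy : y ∈ walshSpanned)
    (hxy : x - y ∈ KZ.relations) : x ∈ walshSpanned := by
  obtain ⟨ι, _, d, P, q, ρ, c, hW, hrel⟩ := hy
  refine ⟨ι, ‹_›, d, P, q, ρ, c, hW, ?_⟩
  have : x - ∑ i, c i • KZ.of (ρ i) = (x - y) + (y - ∑ i, c i • KZ.of (ρ i)) := by abel
  rw [this]
  exact KZ.relations.add_mem hxy hrel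

/-- The Walsh span modulo relations is stable under negation. [folklore] -/
theorem walshSpanned_neg {x : KZ.FormalRep} (hx : x ∈ walshSpanned) : -x ∈ walshSpanned := by
  obtain ⟨ι, _, d, P, q, ρ, c, hW, hrel⟩ := hx
  refine ⟨ι, ‹_›, d, P, q, ρ, fun i => -c i, hW, ?_⟩
  have : -x - ∑ i, (-c i) • KZ.of (ρ i) = -(x - ∑ i, c i • KZ.of (ρ i)) := by
    simp only [neg_smul, Finset.sum_neg_distrib]; abel
  rw [this]
  exact KZ.relations.neg_mem hrel

/-- The Walsh span modulo relations is stable under addition (disjoint union of the families).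
[folklore] -/
theorem walshSpanned_add {x y : KZ.FormalRep} (hx : x ∈ walshSpanned) (hy : y ∈ walshSpanned) :
    x + y ∈ walshSpanned := by
  obtain ⟨ι₁, _, d₁, P₁, q₁, ρ₁, c₁, hW₁, h₁⟩ := hx
  obtain ⟨ι₂, _, d₂, P₂, q₂, ρ₂, c₂, hW₂, h₂⟩ := hy
  let d : ι₁ ⊕ ι₂ → ℕ := Sum.elim d₁ d₂
  let P : (i : ι₁ ⊕ ι₂) → MvPolynomial (Fin (d i)) ℚ := fun i =>
    match i with
    | .inl i => P₁ i
    | .inr i => P₂ i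
  let ρ : (i : ι₁ ⊕ ι₂) → KZ.IntegralRep (d i) := fun i =>
    match i with
    | .inl i => ρ₁ i
    | .inr i => ρ₂ i
  let c : ι₁ ⊕ ι₂ → ℤ := Sum.elim c₁ c₂
  have e : ∑ i, c i • KZ.of (ρ i) = ∑ i, c₁ i • KZ.of (ρ₁ i) + ∑ i, c₂ i • KZ.of (ρ₂ i) :=
    Fintype.sum_sum_type _
  refine ⟨ι₁ ⊕ ι₂, inferInstance, d, P, Sum.elim q₁ q₂, ρ, c, ?_, ?_⟩
  · rintro (i | i)
    · exact hW₁ i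
    · exact hW₂ i
  · rw [e]
    have : x + y - (∑ i, c₁ i • KZ.of (ρ₁ i) + ∑ i, c₂ i • KZ.of (ρ₂ i)) =
        (x - ∑ i, c₁ i • KZ.of (ρ₁ i)) + (y - ∑ i, c₂ i • KZ.of (ρ₂ i)) := by abel
    rw [this]
    exact KZ.relations.add_mem h₁ h₂

/-- The Walsh span modulo relations is stable under subtraction. [folklore] -/
theorem walshSpanned_sub {x y : KZ.FormalRep} (hx : x ∈ walshSpanned) (hy : y ∈ walshSpanned) :
    x - y ∈ walshSpanned := by
  rw [sub_eq_add_neg]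
  exact walshSpanned_add hx (walshSpanned_neg hy)

/-! #### W1 · weighted scissors -/

/-- The integrand-`1` representation on a bounded `ℚ`-semialgebraic set. [folklore] -/
theorem exists_unitRep {N : ℕ} {σ : Set (Fin N → ℝ)} (hσ : IsSemialgebraic ℚ σ)
    (hbd : Bornology.IsBounded σ) :
    ∃ u : KZ.IntegralRep N, u.domain = σ ∧ ∀ x ∈ u.domain, u.integrand x = 1 :=
  ⟨⟨σ, fun _ => 1, hσ, (isSemialgebraicFunOn_aeval hσ 1).congr fun x _ => by simp,
    integrableOn_const (hs := hbd.measure_lt_top.ne)⟩, rfl, fun _ _ => rfl⟩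

/-- `b • [σ, q] − n • [σ, 1] ∈ relations` when `b q = n` (`b : ℕ`, `n : ℤ`, `q : ℚ`): scaling rule
(1) with the tree's `of_constMul_nat_sub_nsmul_mem_relations`. [KontsevichZagier2001 §1.2 (1)] -/
theorem nsmul_of_sub_zsmul_of_unit_mem_relations {N : ℕ} (s u : KZ.IntegralRep N)
    (hu : u.domain = s.domain) (hu1 : ∀ x ∈ u.domain, u.integrand x = 1) {q : ℚ}
    (hs : ∀ x ∈ s.domain, s.integrand x = (q : ℝ)) {b : ℕ} {n : ℤ} (hn : (b : ℚ) * q = n) :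
    b • KZ.of s - n • KZ.of u ∈ KZ.relations := by
  have hnR : ((n : ℤ) : ℝ) = (b : ℝ) * (q : ℝ) := by
    have := congrArg (fun t : ℚ => (t : ℝ)) hn
    push_cast at this
    exact this.symm
  obtain ⟨M, hM | hM⟩ := Int.eq_nat_or_neg n
  · -- `n = M ≥ 0`
    subst hM
    set sb := s.constMul (b : ℝ) (isAlgebraic_nat b) with hsb_def
    set uM := u.constMul (M : ℝ) (isAlgebraic_nat M) with huM_def
    have h1 : KZ.of sb - b • KZ.of s ∈ KZ.relations :=
      KZ.IntegralRep.of_constMul_nat_sub_nsmul_mem_relations s b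
    have h2 : KZ.of uM - M • KZ.of u ∈ KZ.relations :=
      KZ.IntegralRep.of_constMul_nat_sub_nsmul_mem_relations u M
    have h3 : KZ.of sb - KZ.of uM ∈ KZ.relations := by
      refine KZ.of_sub_of_mem_relations_of_eqOn (by simp [hsb_def, huM_def, hu]) fun x hx => ?_
      simp only [hsb_def, KZ.IntegralRep.domain_constMul] at hx
      simp only [hsb_def, huM_def, KZ.IntegralRep.integrand_constMul]
      rw [hs x hx, hu1 x (hu ▸ hx), mul_one, ← hnR]
      push_cast
      rfl
    have : b • KZ.of s - (M : ℤ) • KZ.of u =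
        -(KZ.of sb - b • KZ.of s) + (KZ.of sb - KZ.of uM) + (KZ.of uM - M • KZ.of u) := by
      rw [natCast_zsmul]; abel
    rw [this]
    exact KZ.relations.add_mem (KZ.relations.add_mem (KZ.relations.neg_mem h1) h3) h2
  · -- `n = -M ≤ 0`
    subst hM
    set sb := s.constMul (b : ℝ) (isAlgebraic_nat b) with hsb_def
    set uM := u.constMul (M : ℝ) (isAlgebraic_nat M) with huM_def
    have h1 : KZ.of sb - b • KZ.of s ∈ KZ.relations :=
      KZ.IntegralRep.of_constMul_nat_sub_nsmul_mem_relations s b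
    have h2 : KZ.of uM - M • KZ.of u ∈ KZ.relations :=
      KZ.IntegralRep.of_constMul_nat_sub_nsmul_mem_relations u M
    have h3 : KZ.of sb + KZ.of uM ∈ KZ.relations := by
      refine KZ.of_add_of_mem_relations_of_eqOn_neg (by simp [hsb_def, huM_def, hu]) fun x hx => ?_
      simp only [hsb_def, KZ.IntegralRep.domain_constMul] at hx
      show uM.integrand x = -sb.integrand x
      simp only [hsb_def, huM_def, KZ.IntegralRep.integrand_constMul]
      rw [hs x hx, hu1 x (hu ▸ hx), mul_one, ← hnR]
      push_cast
      ring
    have : b • KZ.of s - (-(M : ℤ)) • KZ.of u =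
        -(KZ.of sb - b • KZ.of s) + (KZ.of sb + KZ.of uM) - (KZ.of uM - M • KZ.of u) := by
      rw [neg_smul, natCast_zsmul]; abel
    rw [this]
    exact KZ.relations.sub_mem (KZ.relations.add_mem (KZ.relations.neg_mem h1) h3) h2

/-- `stub_scissors` over an arbitrary finite index type. -/
theorem scissors_fintype {ι : Type} [Fintype ι] (N : ℕ) (ρ : ι → KZ.IntegralRep N) (ε : ι → ℤ)
    (hone : ∀ i, ∀ x ∈ (ρ i).domain, (ρ i).integrand x = 1)
    (hae : ∀ᵐ x : Fin N → ℝ, ∑ i, (ε i : ℝ) * (ρ i).domain.indicator (fun _ => (1 : ℝ)) x = 0) :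
    ∑ i, ε i • KZ.of (ρ i) ∈ KZ.relations := by
  classical
  let e := Fintype.equivFin ι
  have h := Summit.KontsevichZagierPeriods.SymplecticScissors.LogPolytope.stub_scissors N
    (Fintype.card ι) (fun j => ρ (e.symm j)) (fun j => ε (e.symm j)) (fun j => hone _) (by
      filter_upwards [hae] with x hx
      have : ∑ j, (ε (e.symm j) : ℝ) * (ρ (e.symm j)).domain.indicator (fun _ => (1 : ℝ)) x =
          ∑ i, (ε i : ℝ) * (ρ i).domain.indicator (fun _ => (1 : ℝ)) x :=
        Fintype.sum_equiv e.symm _ _ fun _ => rfl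
      rw [this]
      exact hx)
  have : ∑ j, ε (e.symm j) • KZ.of (ρ (e.symm j)) = ∑ i, ε i • KZ.of (ρ i) :=
    Fintype.sum_equiv e.symm _ _ fun _ => rfl
  rw [this] at h
  exact h

/-- **Weighted scissors.** Finitely many bounded representations of one dimension with constant
rational integrands `q i` and integer coefficients `ε i` with `∑ i, ε i q i 1_{D i} = 0` a.e. give a
relation `∑ i, ε i • [ρ i] ∈ KZ.relations` (common denominator, rule (1) scaling, signed scissors,
torsion-freeness). [KontsevichZagier2001 §1.2 rule (1); tree `stub_scissors`] -/
theorem weighted_scissors {ι : Type} [Fintype ι] (N : ℕ) (ρ : ι → KZ.IntegralRep N) (q : ι → ℚ)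
    (ε : ι → ℤ) (hq : ∀ i, ∀ x ∈ (ρ i).domain, (ρ i).integrand x = (q i : ℝ))
    (hbd : ∀ i, Bornology.IsBounded (ρ i).domain)
    (hae : ∀ᵐ x : Fin N → ℝ,
      ∑ i, (ε i : ℝ) * (q i : ℝ) * (ρ i).domain.indicator (fun _ => (1 : ℝ)) x = 0) :
    ∑ i, ε i • KZ.of (ρ i) ∈ KZ.relations := by
  classical
  have hu : ∀ i, ∃ u : KZ.IntegralRep N, u.domain = (ρ i).domain ∧
      ∀ x ∈ u.domain, u.integrand x = 1 :=
    fun i => exists_unitRep (ρ i).isSemialgebraic_domain (hbd i)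
  choose u hud hu1 using hu
  -- a common denominator
  set b : ℕ := ∏ i, (q i).den with hb_def
  have hb0 : b ≠ 0 := Finset.prod_ne_zero_iff.mpr fun i _ => (q i).den_nz
  have hbq : ∀ i, ∃ n : ℤ, (b : ℚ) * q i = n := by
    intro i
    refine ⟨(q i).num * ∏ j ∈ Finset.univ.erase i, ((q j).den : ℤ), ?_⟩
    have : (b : ℚ) = (q i).den * ∏ j ∈ Finset.univ.erase i, ((q j).den : ℚ) := by
      rw [hb_def]
      push_cast
      exact (Finset.mul_prod_erase Finset.univ (fun j => ((q j).den : ℚ)) (Finset.mem_univ i)).symm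
    rw [this, mul_comm ((q i).den : ℚ), mul_assoc, Rat.den_mul_eq_num]
    push_cast
    ring
  choose n hn using hbq
  -- `b • Σ ε_i [ρ i] ≡ Σ (ε_i n_i) • [u i]`
  have h1 : b • ∑ i, ε i • KZ.of (ρ i) - ∑ i, (ε i * n i) • KZ.of (u i) ∈ KZ.relations := by
    have key : b • ∑ i, ε i • KZ.of (ρ i) - ∑ i, (ε i * n i) • KZ.of (u i) =
        ∑ i, ε i • (b • KZ.of (ρ i) - n i • KZ.of (u i)) := by
      rw [Finset.smul_sum, ← Finset.sum_sub_distrib]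
      refine Finset.sum_congr rfl fun i _ => ?_
      rw [smul_sub, smul_comm, mul_smul]
    rw [key]
    exact KZ.relations.sum_mem fun i _ => KZ.relations.zsmul_mem
      (nsmul_of_sub_zsmul_of_unit_mem_relations (ρ i) (u i) (hud i) (hu1 i) (hq i) (hn i)) _
  -- signed scissors on the unit representations
  have h2 : ∑ i, (ε i * n i) • KZ.of (u i) ∈ KZ.relations := by
    refine scissors_fintype N u (fun i => ε i * n i) hu1 ?_
    filter_upwards [hae] with x hx
    have : ∑ i, ((ε i * n i : ℤ) : ℝ) * (u i).domain.indicator (fun _ => (1 : ℝ)) x =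
        (b : ℝ) * ∑ i, (ε i : ℝ) * (q i : ℝ) * (ρ i).domain.indicator (fun _ => (1 : ℝ)) x := by
      rw [Finset.mul_sum]
      refine Finset.sum_congr rfl fun i _ => ?_
      have hni : ((n i : ℤ) : ℝ) = (b : ℝ) * (q i : ℝ) := by
        have := congrArg (fun t : ℚ => (t : ℝ)) (hn i)
        push_cast at this
        exact this.symm
      rw [hud i]
      push_cast
      rw [hni]
      ring
    rw [this, hx, mul_zero]
  refine mem_relations_of_nsmul_mem_relations hb0 ?_
  have : b • ∑ i, ε i • KZ.of (ρ i) =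
      (b • ∑ i, ε i • KZ.of (ρ i) - ∑ i, (ε i * n i) • KZ.of (u i)) +
        ∑ i, (ε i * n i) • KZ.of (u i) := by abel
  rw [this]
  exact KZ.relations.add_mem h1 h2

end Summit.KontsevichZagierPeriods.RootDecompWalshStrata.WalshSpanProof
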